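import Literature.NumberTheory.EllipticCurves.CuspClassHeckeAnnihilationProofs
import HarnessLib

/-!
# The Eichler–Shimura relation on the cuspidal packet: `a_ℓ·P_b ≡ P_{ℓ⁻¹b} + ℓ·P_{ℓb} (mod Λ₁(f))` (LAW 92.B / THM 93.A)

[Proofs] Theorems only (no definition, no named fact, no sorry).  Namespace
`Literature.NumberTheory.EllipticCurves.ModularForms`; continues `CuspClassHeckeAnnihilationProofs.lean` (THM 92.A, the
primes `ℓ ≡ 1 (mod gcd(m, N))`) to ALL primes `ℓ ∤ N`.

THE STATEMENT (E-es-366 `CuspPacketEichlerShimura` of MEMO-es §93, typed verbatim in `pub/bsd-f2-manin/es/g64/Sketch-es-g64.lean`;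
proved here as `cuspPacketEichlerShimura`): for `f ∈ S₂(Γ₀(N))` with `T_ℓ f = a f`, `ℓ ∤ N` prime, `m ≥ 1` and `b, b₁, b₂`
coprime to `m` with `ℓ·b₁ ≡ b`, `b₂ ≡ ℓ·b (mod gcd(m, N))`, writing `P_x := {∞, x/m}_f − {∞, 0}_f`:
`a·P_b − P_{b₁} − ℓ·P_{b₂} ∈ Λ₁(f)`.
GALOIS READING (not used): `P_x` is the image of the cuspidal divisor `(x/m) − (0)` in the `Γ₁(N)`-optimal quotient, a
torsion point over `ℚ(μ_δ)`, `δ = gcd(m, N)`, with `σ_d P_x = P_{d⁻¹x}`; the relation is `a_ℓ P = (σ_ℓ + ℓσ_ℓ⁻¹) P`, i.e.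
Stevens' `ᵗT_ℓ = τ_ℓ + ℓ⟨ℓ⟩τ_ℓ⁻¹` on cuspidal divisors (Stevens 1982, Thm. 1.3.2(b)) pushed to `A_f`.  THE PROOF HERE is the
elementary Manin-symbol computation of MEMO-es §93.2: `a·X(b/m) = Σ_{j<ℓ} X((b+jm)/(ℓm)) + X(ℓb/m)`; with `t = {∞, κ∞}_f`
for any `κ ∈ Γ₀(N)` of lower-right entry `≡ ℓ`, the generic cusps are `≡ t + X(b₂/m)` (DIAMOND STEP, general form:
`κ(a/c)` has class `(ℓc, ℓ⁻¹a)`), the exceptional one (`ℓ ∤ m`, `ℓ ∣ b + j₀m`) is `≡ X(b₁/m)`, and the last cusp is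
`≡ X(b₂/m)` (`ℓ ∤ m`) or `≡ X(b₁/m) − t` (`ℓ ∣ m`); in both cases `a·X(b/m) ≡ X(b₁/m) + ℓ·X(b₂/m) + (ℓ−1)·t`, and at `b/m = 0`
(THM 92.A's key lemma) `a·X(0) ≡ (ℓ+1)·X(0) + (ℓ−1)·t`; subtract.

## References
* [Stevens1982] G. Stevens, *Arithmetic on modular curves*, Thm. 1.3.1, Thm. 1.3.2(b).
* [DiamondShurman2005] F. Diamond, J. Shurman, *A first course in modular forms*, Prop. 3.8.3, Prop. 5.2.1, Thm. 8.7.2.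
* [CremonaAlgorithms1997] J. E. Cremona, *Algorithms for modular elliptic curves*, §2.4 (2.4.1)–(2.4.2).
* [Manin1972] Ju. I. Manin, *Parabolic points and zeta functions of modular curves*, Prop. 1.4, Thm. 1.6.
-/

noncomputable section

open scoped MatrixGroups ModularForm

open CongruenceSubgroup

namespace Literature.NumberTheory.EllipticCurves.ModularForms

variable {N : ℕ} [NeZero N] (f : CuspForm (Gamma0 N) 2)

omit [NeZero N] in
/-- Transfer of an integer congruence along a divisibility of moduli. [folklore] -/
private theorem intCast_zmod_eq_of_dvd' {m n : ℕ} (h : m ∣ n) {x y : ℤ} (hxy : (x : ZMod n) = y) : (x : ZMod m) = y := by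
  have := congrArg (ZMod.castHom h (ZMod m)) hxy
  simpa using this

/-! ### §1 The diamond step in general form: `κ(a/c)` has class `(ℓc, ℓ⁻¹a)` -/

/-- **The diamond step, general form.**  `κ ∈ Γ₀(N)` with lower-right entry `≡ ℓ (mod N)` (`ℓ ∤ N` prime) and no pole at
`a/c` (`(a, c)` primitive, `c ≠ 0`); `(a', c')` primitive, `c' ≠ 0`, `c' ≡ ℓc (mod N)` and `ℓ·a' ≡ a (mod gcd(c, N))`.  Then
`{∞, a'/c'}_f − {∞, a/c}_f − {∞, κ∞}_f ∈ Λ₁(f)`: `κ(a/c) = p/q` with `q ≡ ℓc ≡ c'`, `p ≡ κ₀₀a ≡ ℓ⁻¹a ≡ a' (mod gcd(c, N) ⊇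
gcd(q, N))`, so Prop. 3.8.3 moves `p/q` to `a'/c'` inside `Γ₁(N)`, and `{∞, κ(a/c)} = {∞, κ∞} + {∞, a/c}` (Manin).
[cite: DiamondShurman2005, Prop. 3.8.3 (PDF p. 120)] [cite: Manin1972, Prop. 1.4, Thm. 1.6] -/
theorem modularSymbol_sub_sub_cuspSymbol_mem_periodLatticeGamma1_of_mul_congr (κ : Gamma0 N) {ℓ : ℕ}
    (hκ : (((κ : SL(2, ℤ)) 1 1 : ℤ) : ZMod N) = (ℓ : ZMod N)) {a c a' c' : ℤ} (hac : IsCoprime a c)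
    (hac' : IsCoprime a' c') (hc0 : c ≠ 0) (hc0' : c' ≠ 0)
    (hpole : ((κ : SL(2, ℤ)) 1 0 : ℚ) * ((a : ℚ) / c) + ((κ : SL(2, ℤ)) 1 1 : ℚ) ≠ 0)
    (hc' : (c' : ZMod N) = (ℓ : ZMod N) * c) (hℓa' : ((ℓ : ZMod (Int.gcd c N))) * a' = a) :
    modularSymbol f ((a' : ℚ) / c') - modularSymbol f ((a : ℚ) / c) - cuspSymbol f κ ∈ periodLatticeGamma1 f := by
  set p : ℤ := (κ : SL(2, ℤ)) 0 0 * a + (κ : SL(2, ℤ)) 0 1 * c with hp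
  set q : ℤ := (κ : SL(2, ℤ)) 1 0 * a + (κ : SL(2, ℤ)) 1 1 * c with hq
  have hdet : ((κ : SL(2, ℤ)) 0 0 : ℤ) * (κ : SL(2, ℤ)) 1 1 - (κ : SL(2, ℤ)) 0 1 * (κ : SL(2, ℤ)) 1 0 = 1 := by
    have h := Matrix.SpecialLinearGroup.det_coe (κ : SL(2, ℤ)); rw [Matrix.det_fin_two] at h; exact h
  have hNκ : (N : ℤ) ∣ (κ : SL(2, ℤ)) 1 0 := dvd_entry_of_mem_Gamma0 N κ.2
  have hcQ : (c : ℚ) ≠ 0 := by exact_mod_cast hc0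
  have hqQ : (q : ℚ) = c * (((κ : SL(2, ℤ)) 1 0 : ℚ) * ((a : ℚ) / c) + ((κ : SL(2, ℤ)) 1 1 : ℚ)) := by
    simp only [hq]; push_cast; field_simp
  have hq0 : q ≠ 0 := by
    intro h0
    have : (q : ℚ) = 0 := by exact_mod_cast h0
    rw [hqQ] at this
    rcases mul_eq_zero.mp this with h1 | h1
    · exact hcQ h1
    · exact hpole h1
  have hpq : IsCoprime p q := by
    obtain ⟨u, v, huv⟩ := hac
    refine ⟨u * (κ : SL(2, ℤ)) 1 1 - v * (κ : SL(2, ℤ)) 1 0, -u * (κ : SL(2, ℤ)) 0 1 + v * (κ : SL(2, ℤ)) 0 0, ?_⟩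
    simp only [hp, hq]; linear_combination (u * a + v * c) * hdet + huv
  have hσ := modularSymbol_gamma0_smul_holds f κ ((a : ℚ) / c) hpole
  have hfrac : (((κ : SL(2, ℤ)) 0 0 : ℚ) * ((a : ℚ) / c) + ((κ : SL(2, ℤ)) 0 1 : ℚ)) /
      (((κ : SL(2, ℤ)) 1 0 : ℚ) * ((a : ℚ) / c) + ((κ : SL(2, ℤ)) 1 1 : ℚ)) = (p : ℚ) / q := by
    have hpQ : (p : ℚ) = c * (((κ : SL(2, ℤ)) 0 0 : ℚ) * ((a : ℚ) / c) + ((κ : SL(2, ℤ)) 0 1 : ℚ)) := by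
      simp only [hp]; push_cast; field_simp
    rw [hpQ, hqQ, mul_div_mul_left _ _ hcQ]
  rw [hfrac] at hσ
  have hcq : (c' : ZMod N) = q := by
    simp only [hq]; push_cast
    rw [(ZMod.intCast_zmod_eq_zero_iff_dvd _ N).mpr hNκ, zero_mul, zero_add, hκ, hc']
  set d : ℕ := Int.gcd c N with hd
  have hd_c : (d : ℤ) ∣ c := Int.gcd_dvd_left c N
  have hd_N : (d : ℤ) ∣ (N : ℤ) := Int.gcd_dvd_right c N
  have hg_q : ((Int.gcd q N : ℕ) : ℤ) ∣ q := Int.gcd_dvd_left q N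
  have hg_N : ((Int.gcd q N : ℕ) : ℤ) ∣ (N : ℤ) := Int.gcd_dvd_right q N
  have hc_eq : c = (κ : SL(2, ℤ)) 0 0 * q - (κ : SL(2, ℤ)) 1 0 * p := by
    simp only [hp, hq]; linear_combination (-c) * hdet
  have hg_c : ((Int.gcd q N : ℕ) : ℤ) ∣ c := by
    rw [hc_eq]; exact dvd_sub (hg_q.mul_left _) ((hg_N.trans hNκ).mul_right _)
  have hg_dvd : Int.gcd q N ∣ d := by
    have h : ((Int.gcd q N : ℕ) : ℤ) ∣ ((d : ℕ) : ℤ) := Int.dvd_coe_gcd hg_c hg_N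
    exact_mod_cast h
  have hκ10_d : (((κ : SL(2, ℤ)) 1 0 : ℤ) : ZMod d) = 0 := (ZMod.intCast_zmod_eq_zero_iff_dvd _ d).mpr (hd_N.trans hNκ)
  have hc_d : ((c : ℤ) : ZMod d) = 0 := (ZMod.intCast_zmod_eq_zero_iff_dvd _ d).mpr hd_c
  have hκ11_d : (((κ : SL(2, ℤ)) 1 1 : ℤ) : ZMod d) = (ℓ : ZMod d) := by
    have h := intCast_zmod_eq_of_dvd' (Int.natCast_dvd_natCast.mp hd_N) (x := (κ : SL(2, ℤ)) 1 1) (y := (ℓ : ℤ))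
      (by push_cast; exact hκ)
    rw [h]; push_cast; rfl
  have hκ00ℓ : (((κ : SL(2, ℤ)) 0 0 : ℤ) : ZMod d) * (ℓ : ZMod d) = 1 := by
    have h := congrArg (Int.cast : ℤ → ZMod d) hdet
    push_cast at h
    rw [hκ10_d, hκ11_d, mul_zero, sub_zero] at h; exact h
  have hp_d : ((p : ℤ) : ZMod d) = a' := by
    simp only [hp]; push_cast
    rw [hc_d, mul_zero, add_zero, ← hℓa', ← mul_assoc, hκ00ℓ, one_mul]
  have ha'p : (a' : ZMod (Int.gcd q N)) = p := by
    apply intCast_zmod_eq_of_dvd' hg_dvd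
    rw [hp_d]
  have hCL := modularSymbol_sub_mem_periodLatticeGamma1_of_congr f hpq hac' hq0 hc0' hcq ha'p
  rw [hσ] at hCL
  convert hCL using 1; ring

/-! ### §2 The Hecke sum at `b/m` against the packet points `b₁/m`, `b₂/m` -/

omit [NeZero N] f in
/-- For `ℓ` prime, `ℓ ∤ m`: the unique `j ∈ [0, ℓ)` with `ℓ ∣ b + jm`. [folklore] -/
private theorem existsUnique_fin_dvd_add_mul' {ℓ : ℕ} (hℓ : ℓ.Prime) {b m : ℤ} (hm : ¬ (ℓ : ℤ) ∣ m) :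
    ∃ j₀ : Fin ℓ, (ℓ : ℤ) ∣ b + ((j₀ : ℕ) : ℤ) * m ∧
      ∀ j : Fin ℓ, (ℓ : ℤ) ∣ b + ((j : ℕ) : ℤ) * m → j = j₀ := by
  haveI : Fact ℓ.Prime := ⟨hℓ⟩
  have hmℓ : ((m : ℤ) : ZMod ℓ) ≠ 0 := by
    rwa [Ne, ZMod.intCast_zmod_eq_zero_iff_dvd]
  set x : ZMod ℓ := -(b : ZMod ℓ) * ((m : ℤ) : ZMod ℓ)⁻¹ with hx
  refine ⟨⟨x.val, x.val_lt⟩, ?_, fun j hj ↦ ?_⟩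
  · rw [← ZMod.intCast_zmod_eq_zero_iff_dvd]
    push_cast
    rw [ZMod.natCast_zmod_val, hx]
    field_simp
    ring
  · have hjx : ((j : ℕ) : ZMod ℓ) = x := by
      have h := (ZMod.intCast_zmod_eq_zero_iff_dvd _ ℓ).mpr hj
      push_cast at h
      rw [hx]
      field_simp
      linear_combination h
    apply Fin.ext
    have h2 : ((j : ℕ) : ZMod ℓ) = ((x.val : ℕ) : ZMod ℓ) := by rw [hjx, ZMod.natCast_zmod_val]
    rw [ZMod.natCast_eq_natCast_iff, Nat.ModEq, Nat.mod_eq_of_lt j.isLt, Nat.mod_eq_of_lt x.val_lt] at h2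
    exact h2

/-- **The Hecke sum at `b/m` modulo `Λ₁(f)`** (`T_ℓ f = a f`, `ℓ ∤ N` prime, `κ ∈ Γ₀(N)` with lower-right entry `≡ ℓ`,
`m ≥ 1`, `b, b₁, b₂` coprime to `m`, `ℓb₁ ≡ b`, `b₂ ≡ ℓb (mod gcd(m, N))`):
`a·{∞, b/m}_f − {∞, b₁/m}_f − ℓ·{∞, b₂/m}_f − (ℓ − 1)·{∞, κ∞}_f ∈ Λ₁(f)` — both cases `ℓ ∤ m` / `ℓ ∣ m` of MEMO-es §93.2.
[cite: Stevens1982, Thm. 1.3.2(b)] [cite: DiamondShurman2005, Prop. 3.8.3, Prop. 5.2.1] [cite: CremonaAlgorithms1997, §2.4 (2.4.1)–(2.4.2)] -/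
theorem modularSymbol_hecke_packet_sub_mem_periodLatticeGamma1 {ℓ : ℕ} [NeZero ℓ] (hℓ : ℓ.Prime) (hℓN : ¬ ℓ ∣ N)
    {a : ℂ} (hT : heckeT (Gamma0 N) 2 ℓ f = a • f) (κ : Gamma0 N)
    (hκ : (((κ : SL(2, ℤ)) 1 1 : ℤ) : ZMod N) = (ℓ : ZMod N)) {m : ℕ} (hm : 0 < m) {b b₁ b₂ : ℤ}
    (hb : IsCoprime b (m : ℤ)) (hb₁ : IsCoprime b₁ (m : ℤ)) (hb₂ : IsCoprime b₂ (m : ℤ))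
    (h₁ : (ℓ : ℤ) * b₁ ≡ b [ZMOD (Nat.gcd m N : ℕ)]) (h₂ : b₂ ≡ (ℓ : ℤ) * b [ZMOD (Nat.gcd m N : ℕ)]) :
    a * modularSymbol f ((b : ℚ) / m) - modularSymbol f ((b₁ : ℚ) / m) - (ℓ : ℂ) * modularSymbol f ((b₂ : ℚ) / m)
      - ((ℓ : ℂ) - 1) * cuspSymbol f κ ∈ periodLatticeGamma1 f := by
  have hℓ0 : (ℓ : ℤ) ≠ 0 := by exact_mod_cast hℓ.ne_zero
  have hℓQ : (ℓ : ℚ) ≠ 0 := by exact_mod_cast hℓ.ne_zero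
  have hℓP : Prime (ℓ : ℤ) := Nat.prime_iff_prime_int.mp hℓ
  set M : ℤ := (m : ℤ) with hM
  have hM0 : M ≠ 0 := by simp [hM, hm.ne']
  have hMQ : (M : ℚ) ≠ 0 := by exact_mod_cast hM0
  have hmQ : ((m : ℕ) : ℚ) = (M : ℚ) := by simp [hM]
  -- the modulus `d = gcd(m, N)`
  have hd_eq : Int.gcd M N = Nat.gcd m N := by rw [hM, Int.gcd_natCast_natCast]
  have hd_M : ((Int.gcd M N : ℕ) : ℤ) ∣ M := Int.gcd_dvd_left M N
  have hd_N : ((Int.gcd M N : ℕ) : ℤ) ∣ (N : ℤ) := Int.gcd_dvd_right M N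
  have hM_d : ((M : ℤ) : ZMod (Int.gcd M N)) = 0 := (ZMod.intCast_zmod_eq_zero_iff_dvd _ _).mpr hd_M
  have h₁' : ((ℓ : ZMod (Int.gcd M N))) * b₁ = b := by
    have h := (ZMod.intCast_eq_intCast_iff _ _ _).mpr h₁
    rw [hd_eq]; push_cast at h ⊢; exact h
  have h₂' : (b₂ : ZMod (Int.gcd M N)) = (ℓ : ZMod (Int.gcd M N)) * b := by
    have h := (ZMod.intCast_eq_intCast_iff _ _ _).mpr h₂
    rw [hd_eq]; push_cast at h ⊢; exact h
  -- `ℓ` is a unit modulo `d ∣ N`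
  have hℓd : IsUnit (ℓ : ZMod (Int.gcd M N)) := by
    rw [ZMod.isUnit_iff_coprime]
    exact Nat.Coprime.coprime_dvd_right (by rw [hd_eq]; exact Nat.gcd_dvd_right m N)
      ((Nat.Prime.coprime_iff_not_dvd hℓ).mpr hℓN)
  -- no pole at `b₂/m`
  obtain ⟨κ₁, hκ₁t, hκ₁d, hκ₁p⟩ := exists_gamma0_cuspSymbol_eq_apply_ne_zero f κ ((b₂ : ℚ) / M)
  rw [hκ] at hκ₁d
  -- the Hecke sum at `x = b/m`
  set x : ℚ := (b : ℚ) / M with hx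
  have hH : a * modularSymbol f x =
      ∑ j : Fin ℓ, modularSymbol f ((x + ((j : ℕ) : ℤ)) / ℓ) + modularSymbol f (ℓ * x) := by
    rw [← modularSymbol_smul, ← hT, modularSymbol_heckeT_eq_sum ℓ f hℓ, if_neg hℓN]
  have hterm : ∀ j : Fin ℓ, (x + ((j : ℕ) : ℤ)) / ℓ = ((b + ((j : ℕ) : ℤ) * M : ℤ) : ℚ) / ((ℓ * M : ℤ) : ℚ) := by
    intro j; rw [hx]; push_cast; field_simp
  rw [hmQ]
  set X₁ := modularSymbol f ((b₁ : ℚ) / M) with hX₁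
  set X₂ := modularSymbol f ((b₂ : ℚ) / M) with hX₂
  set t := cuspSymbol f κ with ht
  -- generic term `j` with `ℓ ∤ b + jm`: `≡ X₂ + t`
  have hgen : ∀ j : Fin ℓ, ¬ (ℓ : ℤ) ∣ b + ((j : ℕ) : ℤ) * M →
      modularSymbol f ((x + ((j : ℕ) : ℤ)) / ℓ) - X₂ - t ∈ periodLatticeGamma1 f := by
    intro j hj
    rw [hterm j, hX₂, ← hκ₁t]
    refine modularSymbol_sub_sub_cuspSymbol_mem_periodLatticeGamma1_of_mul_congr f κ₁ hκ₁d hb₂ ?_ hM0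
      (mul_ne_zero hℓ0 hM0) hκ₁p ?_ ?_
    · have h1 : IsCoprime (b + ((j : ℕ) : ℤ) * M) M := by
        simpa [mul_comm] using hb.add_mul_right_left ((j : ℕ) : ℤ)
      exact IsCoprime.mul_right ((hℓP.coprime_iff_not_dvd.mpr hj).symm) h1
    · push_cast; ring
    · push_cast; rw [hM_d, mul_zero, add_zero, h₂']
  by_cases hℓM : (ℓ : ℤ) ∣ M
  · -- CASE `ℓ ∣ m`: all terms generic; last cusp `ℓ·(b/m) = b/(m/ℓ)` is `≡ X₁ − t`
    obtain ⟨M', hM'⟩ := hℓM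
    have hM'0 : M' ≠ 0 := by rintro rfl; exact hM0 (by rw [hM', mul_zero])
    have hℓb : ¬ (ℓ : ℤ) ∣ b := fun h ↦ hℓP.not_unit (hb.isUnit_of_dvd' h ⟨M', hM'⟩)
    have hall : ∀ j : Fin ℓ, modularSymbol f ((x + ((j : ℕ) : ℤ)) / ℓ) - X₂ - t ∈ periodLatticeGamma1 f := by
      intro j
      refine hgen j fun h ↦ hℓb ?_
      have : (ℓ : ℤ) ∣ ((j : ℕ) : ℤ) * M := Dvd.dvd.mul_left ⟨M', hM'⟩ _
      simpa using (dvd_sub h this)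
    have hbM' : IsCoprime b M' := by
      have h := hb; rw [hM'] at h; exact h.of_mul_right_right
    have hlast_eq : (ℓ : ℚ) * x = (b : ℚ) / M' := by
      rw [hx, hM']; push_cast
      have : (M' : ℚ) ≠ 0 := by exact_mod_cast hM'0
      field_simp
    obtain ⟨κ₂, hκ₂t, hκ₂d, hκ₂p⟩ := exists_gamma0_cuspSymbol_eq_apply_ne_zero f κ ((b : ℚ) / M')
    rw [hκ] at hκ₂d
    have hd'_dvd : Int.gcd M' N ∣ Int.gcd M N := by
      have h1 : ((Int.gcd M' N : ℕ) : ℤ) ∣ M := (Int.gcd_dvd_left M' N).trans ⟨ℓ, by rw [hM', mul_comm]⟩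
      have h : ((Int.gcd M' N : ℕ) : ℤ) ∣ ((Int.gcd M N : ℕ) : ℤ) := Int.dvd_coe_gcd h1 (Int.gcd_dvd_right M' N)
      exact_mod_cast h
    have hlast : X₁ - modularSymbol f (ℓ * x) - t ∈ periodLatticeGamma1 f := by
      rw [hlast_eq, hX₁, ht, ← hκ₂t]
      refine modularSymbol_sub_sub_cuspSymbol_mem_periodLatticeGamma1_of_mul_congr f κ₂ hκ₂d hbM' hb₁ hM'0 hM0 hκ₂p
        ?_ ?_
      · rw [hM']; push_cast; ring
      · have h := intCast_zmod_eq_of_dvd' hd'_dvd (x := ℓ * b₁) (y := b) (by push_cast; exact h₁')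
        push_cast at h; exact h
    have hkey : a * modularSymbol f x - X₁ - (ℓ : ℂ) * X₂ - ((ℓ : ℂ) - 1) * t =
        ∑ j : Fin ℓ, (modularSymbol f ((x + ((j : ℕ) : ℤ)) / ℓ) - X₂ - t) - (X₁ - modularSymbol f (ℓ * x) - t) := by
      rw [Finset.sum_sub_distrib, Finset.sum_sub_distrib, Finset.sum_const, Finset.sum_const, Finset.card_univ,
        Fintype.card_fin, nsmul_eq_mul, nsmul_eq_mul, hH]
      ring
    rw [hkey]
    exact sub_mem (sum_mem fun j _ ↦ hall j) hlast
  · -- CASE `ℓ ∤ m`: the exceptional `j₀` is `≡ X₁`; the last cusp `ℓb/m` is `≡ X₂`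
    obtain ⟨j₀, hj₀, huniq⟩ := existsUnique_fin_dvd_add_mul' hℓ (b := b) hℓM
    obtain ⟨u, hu⟩ := hj₀
    have huM : IsCoprime u M := by
      have h1 : IsCoprime (b + ((j₀ : ℕ) : ℤ) * M) M := by
        simpa [mul_comm] using hb.add_mul_right_left ((j₀ : ℕ) : ℤ)
      rw [hu] at h1
      exact h1.of_mul_left_right
    have hj₀_eq : (x + ((j₀ : ℕ) : ℤ)) / ℓ = (u : ℚ) / M := by
      rw [hterm j₀]
      have huQ : ((b + ((j₀ : ℕ) : ℤ) * M : ℤ) : ℚ) = ℓ * u := by exact_mod_cast hu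
      rw [huQ]; push_cast
      rw [mul_div_mul_left _ _ hℓQ]
    have hexc : modularSymbol f ((x + ((j₀ : ℕ) : ℤ)) / ℓ) - X₁ ∈ periodLatticeGamma1 f := by
      rw [hj₀_eq, hX₁]
      refine modularSymbol_sub_mem_periodLatticeGamma1_of_congr f hb₁ huM hM0 hM0 rfl ?_
      -- `ℓu = b + j₀m ≡ b ≡ ℓb₁ (mod d)`, cancel the unit `ℓ`
      have h := congrArg (fun z : ℤ ↦ (z : ZMod (Int.gcd M N))) hu
      simp only [Int.cast_add, Int.cast_mul, hM_d, mul_zero, add_zero, Int.cast_natCast] at h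
      -- h : b = ℓ * u
      have h3 : (ℓ : ZMod (Int.gcd M N)) * u = (ℓ : ZMod (Int.gcd M N)) * b₁ := by rw [← h, h₁']
      exact hℓd.mul_left_cancel h3
    have hothers : ∀ j : Fin ℓ, j ≠ j₀ →
        modularSymbol f ((x + ((j : ℕ) : ℤ)) / ℓ) - X₂ - t ∈ periodLatticeGamma1 f :=
      fun j hne ↦ hgen j fun h ↦ hne (huniq j h)
    have hlast : modularSymbol f (ℓ * x) - X₂ ∈ periodLatticeGamma1 f := by
      have e : (ℓ : ℚ) * x = ((ℓ * b : ℤ) : ℚ) / M := by rw [hx]; push_cast; ring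
      rw [e, hX₂]
      refine modularSymbol_sub_mem_periodLatticeGamma1_of_congr f hb₂ ?_ hM0 hM0 rfl ?_
      · exact IsCoprime.mul_left (hℓP.coprime_iff_not_dvd.mpr hℓM) hb
      · push_cast; rw [h₂']
    have hsum : ∑ j : Fin ℓ, (modularSymbol f ((x + ((j : ℕ) : ℤ)) / ℓ) - X₂ - t) =
        (modularSymbol f ((x + ((j₀ : ℕ) : ℤ)) / ℓ) - X₂ - t) +
          ∑ j ∈ Finset.univ.erase j₀, (modularSymbol f ((x + ((j : ℕ) : ℤ)) / ℓ) - X₂ - t) :=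
      (Finset.add_sum_erase _ _ (Finset.mem_univ j₀)).symm
    have hkey : a * modularSymbol f x - X₁ - (ℓ : ℂ) * X₂ - ((ℓ : ℂ) - 1) * t =
        (modularSymbol f ((x + ((j₀ : ℕ) : ℤ)) / ℓ) - X₁) +
          ∑ j ∈ Finset.univ.erase j₀, (modularSymbol f ((x + ((j : ℕ) : ℤ)) / ℓ) - X₂ - t) +
          (modularSymbol f (ℓ * x) - X₂) := by
      have h1 : a * modularSymbol f x - X₁ - (ℓ : ℂ) * X₂ - ((ℓ : ℂ) - 1) * t =
          ∑ j : Fin ℓ, (modularSymbol f ((x + ((j : ℕ) : ℤ)) / ℓ) - X₂ - t) + t + X₂ - X₁ +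
            (modularSymbol f (ℓ * x) - X₂) := by
        rw [Finset.sum_sub_distrib, Finset.sum_sub_distrib, Finset.sum_const, Finset.sum_const, Finset.card_univ,
          Fintype.card_fin, nsmul_eq_mul, nsmul_eq_mul, hH]
        ring
      rw [h1, hsum]
      ring
    rw [hkey]
    exact add_mem (add_mem hexc (sum_mem fun j hjm ↦ hothers j (Finset.ne_of_mem_erase hjm))) hlast

/-! ### §3 THEOREM 93.A = LAW 92.B: `a·P_b − P_{b₁} − ℓ·P_{b₂} ∈ Λ₁(f)` -/

/-- **The Eichler–Shimura relation on the cuspidal packet** (E-es-366 of cell bsd-f2-manin): for `f ∈ S₂(Γ₀(N))` with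
`T_ℓ f = a f`, `ℓ ∤ N` prime, `m ≥ 1`, `b, b₁, b₂` coprime to `m` with `ℓb₁ ≡ b`, `b₂ ≡ ℓb (mod gcd(m, N))`:
`a·({∞, b/m} − {∞, 0}) − ({∞, b₁/m} − {∞, 0}) − ℓ·({∞, b₂/m} − {∞, 0}) ∈ Λ₁(f)`.  Key lemma at `b/m` minus THM 92.A's key
lemma at `0` (same `κ`, the `{∞, κ∞}_f` terms cancel).
[cite: Stevens1982, Thm. 1.3.2(b) (ᵗT_ℓ = τ_ℓ + ℓ⟨ℓ⟩τ_ℓ⁻¹ on cuspidal divisors; period-lattice form = MEMO-es §93.2 THM 93.A, proved here)]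
[cite: DiamondShurman2005, Prop. 3.8.3, Thm. 8.7.2] -/
theorem hecke_packet_relation_mem_periodLatticeGamma1 {ℓ : ℕ} [NeZero ℓ] (hℓ : ℓ.Prime) (hℓN : ¬ ℓ ∣ N) {a : ℂ}
    (hT : heckeT (Gamma0 N) 2 ℓ f = a • f) {m : ℕ} (hm : 0 < m) {b b₁ b₂ : ℤ} (hb : IsCoprime b (m : ℤ))
    (hb₁ : IsCoprime b₁ (m : ℤ)) (hb₂ : IsCoprime b₂ (m : ℤ)) (h₁ : (ℓ : ℤ) * b₁ ≡ b [ZMOD (Nat.gcd m N : ℕ)])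
    (h₂ : b₂ ≡ (ℓ : ℤ) * b [ZMOD (Nat.gcd m N : ℕ)]) :
    a * (modularSymbol f ((b : ℚ) / m) - modularSymbol f 0)
      - (modularSymbol f ((b₁ : ℚ) / m) - modularSymbol f 0)
      - (ℓ : ℂ) * (modularSymbol f ((b₂ : ℚ) / m) - modularSymbol f 0) ∈ periodLatticeGamma1 f := by
  have hℓu : IsUnit (ℓ : ZMod N) := by
    rw [← ZMod.coe_unitOfCoprime ℓ ((Nat.Prime.coprime_iff_not_dvd hℓ).mpr hℓN)]
    exact Units.isUnit _
  obtain ⟨κ, hκ⟩ := exists_gamma0_apply_one_one_eq_of_isUnit hℓu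
  have hb' := modularSymbol_hecke_packet_sub_mem_periodLatticeGamma1 f hℓ hℓN hT κ hκ hm hb hb₁ hb₂ h₁ h₂
  have h0 := modularSymbol_hecke_sub_sub_mem_periodLatticeGamma1 f hℓ hℓN hT κ hκ 0
    (by rw [Rat.den_zero, Nat.gcd_one_left]; exact Nat.modEq_one)
  have h := sub_mem hb' h0
  convert h using 1
  ring

/-- **E-es-366 `CuspPacketEichlerShimura`** — verbatim the `Prop` typed by es g64 (`Sketch-es-g64.lean`), now a theorem.
With es g64's proved glue this re-derives E-es-363e (THM 92.A) and feeds E-es-364/365.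
[cite: Stevens1982, Thm. 1.3.2(b); period-lattice form = MEMO-es §93.2, proved here] -/
theorem cuspPacketEichlerShimura :
    ∀ (N : ℕ) [NeZero N] (f : CuspForm (Gamma0 N) 2) (ℓ : ℕ) [NeZero ℓ] (a : ℂ), ℓ.Prime → ¬ ℓ ∣ N →
      heckeT (Gamma0 N) 2 ℓ f = a • f → ∀ (m : ℕ), 0 < m → ∀ (b b₁ b₂ : ℤ),
        IsCoprime b (m : ℤ) → IsCoprime b₁ (m : ℤ) → IsCoprime b₂ (m : ℤ) →
        (ℓ : ℤ) * b₁ ≡ b [ZMOD (Nat.gcd m N : ℕ)] → b₂ ≡ (ℓ : ℤ) * b [ZMOD (Nat.gcd m N : ℕ)] →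
          a * (modularSymbol f ((b : ℚ) / m) - modularSymbol f 0)
            - (modularSymbol f ((b₁ : ℚ) / m) - modularSymbol f 0)
            - (ℓ : ℂ) * (modularSymbol f ((b₂ : ℚ) / m) - modularSymbol f 0) ∈ periodLatticeGamma1 f :=
  fun _ _ f _ _ _ hℓ hℓN hT _ hm _ _ _ hb hb₁ hb₂ h₁ h₂ ↦
    hecke_packet_relation_mem_periodLatticeGamma1 f hℓ hℓN hT hm hb hb₁ hb₂ h₁ h₂

end Literature.NumberTheory.EllipticCurves.ModularForms

end
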